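import Mathlib

/-!
# Telescope geometry (solo-informed, session 13)

Kernel versions of the three combinatorial lemmas L1–L3 of `paper/N6plus-proof.md`
(zero-density bounded perturbations of `ℤ^d` that percolate at `p_c`):

* `Telescope.exists_eq_of_succ_le_succ` — an `ℕ`-valued sequence starting at `0` whose increments
  are at most one takes every value below any later value (used for "a lattice path of diameter
  `≥ n` has a prefix of diameter exactly `n`");
* `Telescope.exists_min_ceil` / `Telescope.exists_box_cover` — a finite set of lattice points whose
  coordinate extents are `≤ n` lies in a box `n•x + [-n,n]^d` with `x ∈ ℤ^d` (ceiling choice);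
* `Telescope.exists_box_cover_junction` — if the set also lies in `n•(2b) + [-2n,2n]^d` then the
  same `x` satisfies `‖x - 2b‖_∞ ≤ 2` (so `5^d` boxes of scale `n` around a junction box of scale
  `2n` suffice; the constant `2` is sharp).
-/

namespace Summit.CriticalPhenomena.PercolationContinuityZ3.Theorems
namespace Telescope

/-- L3: discrete intermediate values for a sequence with increments at most one. -/
theorem exists_eq_of_succ_le_succ (f : ℕ → ℕ) (h0 : f 0 = 0)
    (hstep : ∀ k, f (k + 1) ≤ f k + 1) {m n : ℕ} (hmn : n ≤ f m) : ∃ k ≤ m, f k = n := by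
  induction m generalizing n with
  | zero => exact ⟨0, le_rfl, by omega⟩
  | succ m ih =>
      by_cases h : n ≤ f m
      · obtain ⟨k, hk, hfk⟩ := ih h
        exact ⟨k, by omega, hfk⟩
      · refine ⟨m + 1, le_rfl, ?_⟩
        have := hstep m
        omega

/-- Ceiling witness: for `0 < n` every integer `L` admits `x` with `L ≤ n*x < L + n`. -/
theorem exists_ceilIndex {n : ℤ} (hn : 0 < n) (L : ℤ) :
    ∃ x : ℤ, L ≤ n * x ∧ n * x < L + n := by
  refine ⟨-((-L) / n), ?_, ?_⟩
  · have h1 := Int.mul_ediv_add_emod (-L) n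
    have h2 := Int.emod_nonneg (-L) (ne_of_gt hn)
    have h3 : n * -(-L / n) = -(n * (-L / n)) := by ring
    linarith
  · have h1 := Int.mul_ediv_add_emod (-L) n
    have h2 := Int.emod_lt_of_pos (-L) hn
    have h3 : n * -(-L / n) = -(n * (-L / n)) := by ring
    linarith

/-- L1 in one coordinate. -/
theorem box_cover_1d {n L R a x : ℤ} (hLa : L ≤ a) (haR : a ≤ R) (hRL : R - L ≤ n)
    (hx1 : L ≤ n * x) (hx2 : n * x < L + n) : n * x - n ≤ a ∧ a ≤ n * x + n := by
  constructor <;> linarith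

/-- L2 in one coordinate: the junction index bound `|x - 2b| ≤ 2`. -/
theorem junction_index_1d {n b L x : ℤ} (hn : 0 < n) (hL1 : n * (2 * b) - 2 * n ≤ L)
    (hL2 : L ≤ n * (2 * b) + 2 * n) (hx1 : L ≤ n * x) (hx2 : n * x < L + n) :
    2 * b - 2 ≤ x ∧ x ≤ 2 * b + 2 := by
  constructor
  · have e : n * (2 * b - 2) = n * (2 * b) - 2 * n := by ring
    have h : n * (2 * b - 2) ≤ n * x := by linarith
    exact le_of_mul_le_mul_left h hn
  · have e : n * (2 * b + 3) = n * (2 * b) + 2 * n + n := by ring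
    have h : n * x < n * (2 * b + 3) := by linarith
    have := lt_of_mul_lt_mul_left h hn.le
    omega

/-- Coordinatewise minima of a finite nonempty set and their ceiling indices. -/
theorem exists_min_ceil {d : ℕ} {n : ℤ} (hn : 0 < n) (A : Finset (Fin d → ℤ))
    (hA : A.Nonempty) :
    ∃ L x : Fin d → ℤ, (∀ i, ∃ a ∈ A, a i = L i) ∧ (∀ a ∈ A, ∀ i, L i ≤ a i) ∧
      ∀ i, L i ≤ n * x i ∧ n * x i < L i + n := by
  classical
  have hL : ∀ i, ∃ L : ℤ, (∃ a ∈ A, a i = L) ∧ ∀ a ∈ A, L ≤ a i := fun i => by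
    obtain ⟨a₀, ha₀, hmin⟩ := A.exists_min_image (fun a => a i) hA
    exact ⟨a₀ i, ⟨a₀, ha₀, rfl⟩, hmin⟩
  choose L hLmem hLle using hL
  have hx : ∀ i, ∃ x : ℤ, L i ≤ n * x ∧ n * x < L i + n := fun i => exists_ceilIndex hn (L i)
  choose x hx1 hx2 using hx
  exact ⟨L, x, hLmem, fun a ha i => hLle i a ha, fun i => ⟨hx1 i, hx2 i⟩⟩

/-- L1: a finite nonempty set of lattice points with coordinate extents `≤ n` lies in some box
`n•x + [-n, n]^d`, `x ∈ ℤ^d`. -/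
theorem exists_box_cover {d : ℕ} {n : ℤ} (hn : 0 < n) (A : Finset (Fin d → ℤ))
    (hA : A.Nonempty) (hdiam : ∀ a ∈ A, ∀ a' ∈ A, ∀ i, a i - a' i ≤ n) :
    ∃ x : Fin d → ℤ, ∀ a ∈ A, ∀ i, n * x i - n ≤ a i ∧ a i ≤ n * x i + n := by
  obtain ⟨L, x, hLmem, hLle, hx⟩ := exists_min_ceil hn A hA
  refine ⟨x, fun a ha i => ?_⟩
  obtain ⟨a₀, ha₀, ha₀i⟩ := hLmem i
  have h2 : a i - a₀ i ≤ n := hdiam a ha a₀ ha₀ i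
  exact box_cover_1d (hLle a ha i) (le_refl (a i)) (by rw [ha₀i] at h2; linarith)
    (hx i).1 (hx i).2

/-- L1 + L2: if moreover the set lies in the box `n•(2b) + [-2n, 2n]^d` (a junction box of scale
`2n` centred on the even coarse lattice), the covering index satisfies `‖x - 2b‖_∞ ≤ 2`. -/
theorem exists_box_cover_junction {d : ℕ} {n : ℤ} (hn : 0 < n) (A : Finset (Fin d → ℤ))
    (hA : A.Nonempty) (hdiam : ∀ a ∈ A, ∀ a' ∈ A, ∀ i, a i - a' i ≤ n) (b : Fin d → ℤ)
    (hin : ∀ a ∈ A, ∀ i, n * (2 * b i) - 2 * n ≤ a i ∧ a i ≤ n * (2 * b i) + 2 * n) :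
    ∃ x : Fin d → ℤ, (∀ a ∈ A, ∀ i, n * x i - n ≤ a i ∧ a i ≤ n * x i + n) ∧
      ∀ i, 2 * b i - 2 ≤ x i ∧ x i ≤ 2 * b i + 2 := by
  obtain ⟨L, x, hLmem, hLle, hx⟩ := exists_min_ceil hn A hA
  refine ⟨x, fun a ha i => ?_, fun i => ?_⟩
  · obtain ⟨a₀, ha₀, ha₀i⟩ := hLmem i
    have h2 : a i - a₀ i ≤ n := hdiam a ha a₀ ha₀ i
    exact box_cover_1d (hLle a ha i) (le_refl (a i)) (by rw [ha₀i] at h2; linarith)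
      (hx i).1 (hx i).2
  · obtain ⟨a₀, ha₀, ha₀i⟩ := hLmem i
    have hb := hin a₀ ha₀ i
    rw [ha₀i] at hb
    exact junction_index_1d hn hb.1 hb.2 (hx i).1 (hx i).2

/-- Sharpness of the constant in L2 (cf. rollout I4/P3): with `n = 1`, `b = 1`, `L = 0`, `x = 0`
all hypotheses of `junction_index_1d` hold and `x = 2b - 2`. -/
theorem junction_index_sharp :
    ∃ n b L x : ℤ, 0 < n ∧ n * (2 * b) - 2 * n ≤ L ∧ L ≤ n * (2 * b) + 2 * n ∧ L ≤ n * x ∧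
      n * x < L + n ∧ x = 2 * b - 2 :=
  ⟨1, 1, 0, 0, by norm_num⟩

end Telescope
end Summit.CriticalPhenomena.PercolationContinuityZ3.Theorems
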